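import Summits.QuantumAdvantage.QuantumAdvantage.Theorems.CubicForrelationSignedExactCubicForrelationNotPrBPPGrowMachineBricks

/-!
# Crux `CubicForrelation.SignedExactCubicForrelationNotPrBPP` (stmt-QuantumAdvantage-13932), line `dual-pingpong-frame`
# (GROW reshape): the GROW machine, II — the two-sided offset closure, the acceptance test and the candidates

Support file (`--supports stmt-QuantumAdvantage-13932`) toward the registered stub `stub_growFinder`; sequel of
`…GrowMachineBricks.lean`. In the context `(n, c_f, c_g)` (the circuit codes of `f = C₀`, acting on the `U`-side,
and `g = C₁`, acting on the `S`-side) this file defines, on PAIRS `(S, U)` of row lists: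

* `closeRound` — one round of the two-sided OFFSET CLOSURE: if `(S, U)` is not closed for `g`
  (`closedChk n c_g S U` fails) replace `U` by a basis of `U ++ Λ_g(S)`; else if `(U, S)` is not closed for `f`
  replace `S` by a basis of `S ++ Λ_f(U)`; else keep the pair (frozen) — `closure` runs `n + 1` rounds;
* `okPair` — the ACCEPTANCE TEST: closed both ways, both ranks `≤ m`, and `S ⊥ U` (`orthChk`);
* `candA`, `candK`, `candV` — the CANDIDATE of a trial: the rows whose kernel is
  `K = Z_g(S) ∩ U^⊥ ∩ ⋂ⱼ rad B^g_{xⱼ}` (stacked slices of `S`, the rows of `U`, stacked slices of the probes `xⱼ`,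
  and the offsets `ℓ_{sᵢ}` of `S` solved on the kernel of the former — on which they are linear), and the selected
  kernel combination `v = ⊕_{f free, sel_f} kvec f` (`MMReadout.kers`, `QuadSampler.xorSel`);
* `tryB` — the `b`-SIDE STEP: reject if `v ∈ span S`, else close `(basis (S ++ [v]), U)` and accept iff `okPair`;
  `tryA` — the symmetric `a`-side step (the `b`-side step of the swapped pair with the circuits exchanged),

and proves them polynomial time on codes (`closure_codeFP`, `tryB_codeFP`, `tryA_codeFP`): the closure is a
`FinderMachine.foldlInv` fold whose states are componentwise either the initial pair or shaped bases.

## References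

* S. Arora, B. Barak, *Computational Complexity: A Modern Approach*, CUP 2009, §1.3. [AroraBarak2009]
* C. Carlet, *Boolean Functions for Cryptography and Coding Theory*, CUP 2021, Prop. 54. [Carlet2020]
* D. E. Knuth, *TAOCP* Vol. 2, 3rd ed., §4.6.2 Algorithm N. [KnuthTAOCP2]
-/

noncomputable section

set_option linter.dupNamespace false -- D-0017: single-problem summit ⇒ `QuantumAdvantage.QuantumAdvantage` by design

namespace Summit.QuantumAdvantage.QuantumAdvantage.Theorems.SignedExactCubicForrelationNotPrBPP.GrowMachine

open _root_.Computability Literature.Computability.Complexity Literature.Computability.Complexity.CodeFP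
open Literature.Computability.QuantumComplexity
open Literature.Computability.Complexity.F2Elim (bxorL Row rrun isPiv prow kvec bitsE stCE)
open ForrCode QuadSampler CubicDequant MMReadout
open FinderMachine (Vec Mat matE normV basisOf kerOf inSpan shaped_basisOf basisOf_codeFP kerOf_codeFP inSpan_codeFP
  normV_codeFP shapeP shapeP_eval length_matE_le length_matE_le_shapeP foldlInv)

/-! ### The machine: closure, acceptance, candidates, steps -/

/-- **One round of the two-sided offset closure** of `(S, U)`: grow `U` by `Λ_g(S)` if `(S, U)` is not closed for
`g`, else grow `S` by `Λ_f(U)` if `(U, S)` is not closed for `f`, else freeze. [cite: Carlet2020, Prop. 54] -/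
def closeRound (n : ℕ) (cf cg : PCirc) (p : Mat × Mat) : Mat × Mat :=
  if closedChk n cg p.1 p.2 then (if closedChk n cf p.2 p.1 then p else (basisOf n (p.1 ++ lamOf n cf p.2), p.2))
  else (p.1, basisOf n (p.2 ++ lamOf n cg p.1))

/-- **The closure**: `n + 1` rounds. [cite: Carlet2020, Prop. 54] -/
def closure (n : ℕ) (cf cg : PCirc) (p : Mat × Mat) : Mat × Mat :=
  (List.replicate (n + 1) ()).foldl (fun q _ => closeRound n cf cg q) p

/-- **The acceptance test** of a pair: closed both ways, both ranks `≤ m`, and orthogonal. [cite: Carlet2020, Prop. 54] -/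
def okPair (n m : ℕ) (cf cg : PCirc) (p : Mat × Mat) : Bool :=
  closedChk n cg p.1 p.2 && closedChk n cf p.2 p.1 && decide (p.1.length ≤ m) && decide (p.2.length ≤ m) && orthChk n p.1 p.2

/-- The rows whose kernel is `⋂ᵢ rad B_{sᵢ} ∩ U^⊥ ∩ ⋂ⱼ rad B_{xⱼ}`. [cite: Carlet2020, §2.2.2] -/
def candA (n : ℕ) (c : PCirc) (S U xs : Mat) : Mat := stackOf n c S ++ U ++ stackOf n c xs

/-- **The candidate rows**: `candA` and the offsets of `S` solved on its kernel (kernel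
`K = Z_c(S) ∩ U^⊥ ∩ ⋂ⱼ rad B_{xⱼ}`). [cite: Carlet2020, §2.2.2] -/
def candK (n : ℕ) (c : PCirc) (S U xs : Mat) : Mat := candA n c S U xs ++ offsOf n c S (candA n c S U xs)

/-- **The candidate vector**: the kernel combination `⊕_{f free, sel_f} kvec f` of the reduced candidate rows
(`MMReadout.kers`). [cite: KnuthTAOCP2, §4.6.2 Algorithm N] -/
def candV (n : ℕ) (c : PCirc) (S U xs : Mat) (sel : Vec) : Vec := xorSel n (kers n (rrun n (candK n c S U xs))) sel

/-- **The `b`-side step**: reject a candidate in `span S`; otherwise close `(basis (S ++ [v]), U)` and return it iff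
it passes the acceptance test. [cite: Carlet2020, Prop. 54] -/
def tryB (n m : ℕ) (cf cg : PCirc) (p : Mat × Mat) (xs : Mat) (sel : Vec) : Option (Mat × Mat) :=
  if inSpan n p.1 (candV n cg p.1 p.2 xs sel) then none
  else if okPair n m cf cg (closure n cf cg (basisOf n (p.1 ++ [candV n cg p.1 p.2 xs sel]), p.2)) then
    some (closure n cf cg (basisOf n (p.1 ++ [candV n cg p.1 p.2 xs sel]), p.2))
  else none

/-- **The `a`-side step**: the `b`-side step of the swapped pair with the two circuits exchanged. [cite: Carlet2020, Prop. 54] -/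
def tryA (n m : ℕ) (cf cg : PCirc) (p : Mat × Mat) (xs : Mat) (sel : Vec) : Option (Mat × Mat) :=
  (tryB n m cg cf p.swap xs sel).map Prod.swap

/-! ### Shapes -/

/-- `closeRound` keeps each component or replaces it by a basis. [folklore] -/
theorem closeRound_or (n : ℕ) (cf cg : PCirc) (p : Mat × Mat) :
    ((closeRound n cf cg p).1 = p.1 ∨ (((closeRound n cf cg p).1).length ≤ n ∧ ∀ r ∈ (closeRound n cf cg p).1, r.length ≤ n)) ∧
      ((closeRound n cf cg p).2 = p.2 ∨ (((closeRound n cf cg p).2).length ≤ n ∧ ∀ r ∈ (closeRound n cf cg p).2, r.length ≤ n)) := by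
  unfold closeRound; split_ifs
  · exact ⟨Or.inl rfl, Or.inl rfl⟩
  · exact ⟨Or.inr (shaped_basisOf _ _), Or.inl rfl⟩
  · exact ⟨Or.inl rfl, Or.inr (shaped_basisOf _ _)⟩

/-- Along the closure each component is the initial one or shaped. [folklore] -/
theorem closure_or (n : ℕ) (cf cg : PCirc) (p : Mat × Mat) (k : ℕ) :
    (((List.replicate k ()).foldl (fun q _ => closeRound n cf cg q) p).1 = p.1 ∨
        ((((List.replicate k ()).foldl (fun q _ => closeRound n cf cg q) p).1).length ≤ n ∧ ∀ r ∈ ((List.replicate k ()).foldl (fun q _ => closeRound n cf cg q) p).1, r.length ≤ n)) ∧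
      (((List.replicate k ()).foldl (fun q _ => closeRound n cf cg q) p).2 = p.2 ∨
        ((((List.replicate k ()).foldl (fun q _ => closeRound n cf cg q) p).2).length ≤ n ∧ ∀ r ∈ ((List.replicate k ()).foldl (fun q _ => closeRound n cf cg q) p).2, r.length ≤ n)) := by
  induction k with
  | zero => exact ⟨Or.inl rfl, Or.inl rfl⟩
  | succ k ih =>
    rw [List.replicate_succ', List.foldl_append, List.foldl_cons, List.foldl_nil]
    obtain ⟨h1, h2⟩ := closeRound_or n cf cg ((List.replicate k ()).foldl (fun q _ => closeRound n cf cg q) p)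
    refine ⟨?_, ?_⟩
    · rcases h1 with h | h
      · rw [h]; exact ih.1
      · exact Or.inr h
    · rcases h2 with h | h
      · rw [h]; exact ih.2
      · exact Or.inr h

/-- **The closure of a shaped pair is shaped.** [folklore] -/
theorem shaped_closure (n : ℕ) (cf cg : PCirc) {p : Mat × Mat} (h1 : ((p.1).length ≤ n ∧ ∀ r ∈ p.1, r.length ≤ n)) (h2 : ((p.2).length ≤ n ∧ ∀ r ∈ p.2, r.length ≤ n)) :
    (((closure n cf cg p).1).length ≤ n ∧ ∀ r ∈ (closure n cf cg p).1, r.length ≤ n) ∧ (((closure n cf cg p).2).length ≤ n ∧ ∀ r ∈ (closure n cf cg p).2, r.length ≤ n) := by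
  obtain ⟨ha, hb⟩ := closure_or n cf cg p (n + 1)
  refine ⟨?_, ?_⟩
  · rcases ha with h | h
    · unfold closure; rw [h]; exact h1
    · exact h
  · rcases hb with h | h
    · unfold closure; rw [h]; exact h2
    · exact h

/-- `tryB` returns closures of shaped pairs. [folklore] -/
theorem shaped_tryB (n m : ℕ) (cf cg : PCirc) {p : Mat × Mat} (h2 : ((p.2).length ≤ n ∧ ∀ r ∈ p.2, r.length ≤ n)) (xs : Mat) (sel : Vec) {q : Mat × Mat}
    (hq : tryB n m cf cg p xs sel = some q) : ((q.1).length ≤ n ∧ ∀ r ∈ q.1, r.length ≤ n) ∧ ((q.2).length ≤ n ∧ ∀ r ∈ q.2, r.length ≤ n) := by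
  unfold tryB at hq
  split_ifs at hq
  cases hq
  exact shaped_closure n cf cg (shaped_basisOf _ _) h2

/-- `tryA` returns shaped pairs. [folklore] -/
theorem shaped_tryA (n m : ℕ) (cf cg : PCirc) {p : Mat × Mat} (h1 : ((p.1).length ≤ n ∧ ∀ r ∈ p.1, r.length ≤ n)) (xs : Mat) (sel : Vec) {q : Mat × Mat}
    (hq : tryA n m cf cg p xs sel = some q) : ((q.1).length ≤ n ∧ ∀ r ∈ q.1, r.length ≤ n) ∧ ((q.2).length ≤ n ∧ ∀ r ∈ q.2, r.length ≤ n) := by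
  unfold tryA at hq
  cases h : tryB n m cg cf p.swap xs sel with
  | none => rw [h] at hq; cases hq
  | some q' =>
    rw [h] at hq
    cases hq
    have := shaped_tryB n m cg cf (p := p.swap) h1 xs sel h
    exact ⟨this.2, this.1⟩

/-! ### Polynomial time -/

/-- The code of the closure context `(n, (c_f, c_g))`. [folklore] -/
abbrev G3E : ℕ × (PCirc × PCirc) → List Bool := pairE unE (pairE pcE pcE)

/-- The code of a pair of row lists. [folklore] -/
abbrev prE : Mat × Mat → List Bool := pairE matE matE

/-- **One closure round on codes**: `((n, (c_f, c_g)), p) ↦ closeRound n c_f c_g p`. [cite: AroraBarak2009, §1.3] -/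
theorem closeRound_codeFP : CodeFP (pairE G3E prE) prE (fun t => closeRound t.1.1 t.1.2.1 t.1.2.2 t.2) := by
  have hn : CodeFP (pairE G3E prE) unE (fun t => t.1.1) := (fst _ _).fst'
  have hcf : CodeFP (pairE G3E prE) pcE (fun t => t.1.2.1) := (fst _ _).snd'.fst'
  have hcg : CodeFP (pairE G3E prE) pcE (fun t => t.1.2.2) := (fst _ _).snd'.snd'
  have hS : CodeFP (pairE G3E prE) matE (fun t => t.2.1) := (snd _ _).fst'
  have hU : CodeFP (pairE G3E prE) matE (fun t => t.2.2) := (snd _ _).snd'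
  have hcg' := closedChk_codeFP.comp (hn.pair (hcg.pair (hS.pair hU)))
  have hcf' := closedChk_codeFP.comp (hn.pair (hcf.pair (hU.pair hS)))
  have hS' := basisOf_codeFP.comp (hn.pair ((rawAppend bitsE).comp (hS.pair (lamOf_codeFP.comp (hn.pair (hcf.pair hU))))))
  have hU' := basisOf_codeFP.comp (hn.pair ((rawAppend bitsE).comp (hU.pair (lamOf_codeFP.comp (hn.pair (hcg.pair hS))))))
  exact (hcg'.ite (hcf'.ite (snd _ _) (hS'.pair hU)) (hS.pair hU')).congr fun _ => rfl

/-- A pair whose components are each bounded by the input or shaped has a polynomially bounded code. [folklore] -/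
theorem length_prE_le {n L : ℕ} {p q : Mat × Mat} (hn : n ≤ L) (hp : (prE p).length ≤ L)
    (h1 : q.1 = p.1 ∨ ((q.1).length ≤ n ∧ ∀ r ∈ q.1, r.length ≤ n)) (h2 : q.2 = p.2 ∨ ((q.2).length ≤ n ∧ ∀ r ∈ q.2, r.length ≤ n)) :
    (prE q).length ≤ 3 * (L + shapeP.eval L) + 2 := by
  have hp' : 2 * (matE p.1).length + 2 + (matE p.2).length ≤ L := by
    have h := hp; simp only [prE, pairE_apply, length_boolPair] at h; exact h
  have b1 : (matE q.1).length ≤ L + shapeP.eval L := by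
    rcases h1 with h | h
    · rw [h]; omega
    · exact (length_matE_le_shapeP h hn).trans (Nat.le_add_left _ _)
  have b2 : (matE q.2).length ≤ L + shapeP.eval L := by
    rcases h2 with h | h
    · rw [h]; omega
    · exact (length_matE_le_shapeP h hn).trans (Nat.le_add_left _ _)
  show (boolPair (matE q.1) (matE q.2)).length ≤ _
  rw [length_boolPair]
  omega

/-- **The closure on codes**: `((n, (c_f, c_g)), p) ↦ closure n c_f c_g p` (a fold whose states are componentwise the
initial pair or shaped bases). [cite: AroraBarak2009, §1.3] -/
theorem closure_codeFP : CodeFP (pairE G3E prE) prE (fun t => closure t.1.1 t.1.2.1 t.1.2.2 t.2) := by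
  have hstep := closeRound_codeFP.comp ((fst (pairE G3E prE) (pairE unitE prE)).fst'.pair (snd (pairE G3E prE) (pairE unitE prE)).snd')
  have hfold := foldlInv (σ := (ℕ × (PCirc × PCirc)) × (Mat × Mat)) (α := Unit) (β := Mat × Mat) (eσ := pairE G3E prE)
    (eα := unitE) (eβ := prE)
    (step := fun c _ q => closeRound c.1.1 c.1.2.1 c.1.2.2 q) (init := fun c => c.2)
    (fun c q => (q.1 = c.2.1 ∨ ((q.1).length ≤ c.1.1 ∧ ∀ r ∈ q.1, r.length ≤ c.1.1)) ∧ (q.2 = c.2.2 ∨ ((q.2).length ≤ c.1.1 ∧ ∀ r ∈ q.2, r.length ≤ c.1.1))) hstep (snd _ _)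
    (3 * (Polynomial.X + shapeP) + 2)
    (fun c => ⟨Or.inl rfl, Or.inl rfl⟩)
    (fun c _ q hq => by
      obtain ⟨h1, h2⟩ := closeRound_or c.1.1 c.1.2.1 c.1.2.2 q
      refine ⟨?_, ?_⟩
      · rcases h1 with h | h
        · rw [h]; exact hq.1
        · exact Or.inr h
      · rcases h2 with h | h
        · rw [h]; exact hq.2
        · exact Or.inr h)
    (fun c q hq => by
      have hL : c.1.1 ≤ (pairE G3E prE c).length := by
        simp only [pairE_apply, length_boolPair, length_unE]; omega
      have hp : (prE c.2).length ≤ (pairE G3E prE c).length := by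
        rw [pairE_apply (pairE unE (pairE pcE pcE)) prE, length_boolPair]; omega
      have h := length_prE_le hL hp hq.1 hq.2
      simpa using h)
  have h := hfold.comp ((CodeFP.id _).pair (replicateUnit.comp (unSucc.comp (fst G3E prE).fst')))
  exact h.congr fun _ => rfl

/-- The code of the full context `Γ = (n, (m, (c_f, c_g)))`. [folklore] -/
abbrev G4E : ℕ × (ℕ × (PCirc × PCirc)) → List Bool := pairE unE (pairE unE (pairE pcE pcE))

/-- **The acceptance test on codes**: `(Γ, p) ↦ okPair n m c_f c_g p`. [cite: AroraBarak2009, §1.3] -/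
theorem okPair_codeFP : CodeFP (pairE G4E prE) bitE (fun t => okPair t.1.1 t.1.2.1 t.1.2.2.1 t.1.2.2.2 t.2) := by
  have hn : CodeFP (pairE G4E prE) unE (fun t => t.1.1) := (fst _ _).fst'
  have hm : CodeFP (pairE G4E prE) unE (fun t => t.1.2.1) := (fst _ _).snd'.fst'
  have hcf : CodeFP (pairE G4E prE) pcE (fun t => t.1.2.2.1) := (fst _ _).snd'.snd'.fst'
  have hcg : CodeFP (pairE G4E prE) pcE (fun t => t.1.2.2.2) := (fst _ _).snd'.snd'.snd'
  have hS : CodeFP (pairE G4E prE) matE (fun t => t.2.1) := (snd _ _).fst'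
  have hU : CodeFP (pairE G4E prE) matE (fun t => t.2.2) := (snd _ _).snd'
  have h1 := closedChk_codeFP.comp (hn.pair (hcg.pair (hS.pair hU)))
  have h2 := closedChk_codeFP.comp (hn.pair (hcf.pair (hU.pair hS)))
  have h3 := natLe.comp (((natLength bitsE).comp hS).pair (natOfUn.comp hm))
  have h4 := natLe.comp (((natLength bitsE).comp hU).pair (natOfUn.comp hm))
  have h5 := orthChk_codeFP.comp (hn.pair (hS.pair hU))
  exact ((((h1.and h2).and h3).and h4).and h5).congr fun _ => rfl

/-- The code of the candidate context `((n, c), (S, (U, xs)))`. [folklore] -/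
abbrev CAE : (ℕ × PCirc) × (Mat × (Mat × Mat)) → List Bool := pairE (pairE unE pcE) (pairE matE (pairE matE matE))

/-- The candidate rows on codes: `((n, c), (S, (U, xs))) ↦ candK n c S U xs`. [cite: AroraBarak2009, §1.3] -/
theorem candK_codeFP : CodeFP CAE matE (fun t => candK t.1.1 t.1.2 t.2.1 t.2.2.1 t.2.2.2) := by
  have hn : CodeFP CAE unE (fun t => t.1.1) := (fst _ _).fst'
  have hc : CodeFP CAE pcE (fun t => t.1.2) := (fst _ _).snd'
  have hS : CodeFP CAE matE (fun t => t.2.1) := (snd _ _).fst'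
  have hU : CodeFP CAE matE (fun t => t.2.2.1) := (snd _ _).snd'.fst'
  have hxs : CodeFP CAE matE (fun t => t.2.2.2) := (snd _ _).snd'.snd'
  have hstS := stackOf_codeFP.comp (hn.pair (hc.pair hS))
  have hstX := stackOf_codeFP.comp (hn.pair (hc.pair hxs))
  have hA := (rawAppend bitsE).comp (((rawAppend bitsE).comp (hstS.pair hU)).pair hstX)
  have hoff := offsOf_codeFP.comp (hn.pair (hc.pair (hS.pair hA)))
  exact ((rawAppend bitsE).comp (hA.pair hoff)).congr fun _ => rfl

/-- **The candidate vector on codes**: `(((n, c), (S, (U, xs))), sel) ↦ candV n c S U xs sel`. [cite: AroraBarak2009, §1.3] -/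
theorem candV_codeFP : CodeFP (pairE CAE bitsE) bitsE (fun t => candV t.1.1.1 t.1.1.2 t.1.2.1 t.1.2.2.1 t.1.2.2.2 t.2) := by
  have hn : CodeFP (pairE CAE bitsE) unE (fun t => t.1.1.1) := (fst _ _).fst'.fst'
  have hK := candK_codeFP.comp (fst CAE bitsE)
  have hR := F2Elim.rrun_codeFP.comp (hn.pair hK)
  have hk := kers_codeFP.comp (hn.pair hR)
  exact (xorSel_codeFP.comp (hn.pair (hk.pair (snd _ _)))).congr fun _ => rfl

/-- The code of the step context `(Γ, (p, (xs, sel)))`. [folklore] -/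
abbrev TBE : (ℕ × (ℕ × (PCirc × PCirc))) × ((Mat × Mat) × (Mat × Vec)) → List Bool := pairE G4E (pairE prE (pairE matE bitsE))

/-- **The `b`-side step on codes**: `(Γ, (p, (xs, sel))) ↦ tryB n m c_f c_g p xs sel`. [cite: AroraBarak2009, §1.3] -/
theorem tryB_codeFP : CodeFP TBE (optE prE) (fun t => tryB t.1.1 t.1.2.1 t.1.2.2.1 t.1.2.2.2 t.2.1 t.2.2.1 t.2.2.2) := by
  have hΓ : CodeFP TBE G4E (fun t => t.1) := fst _ _
  have hn : CodeFP TBE unE (fun t => t.1.1) := (fst _ _).fst'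
  have hcf : CodeFP TBE pcE (fun t => t.1.2.2.1) := (fst _ _).snd'.snd'.fst'
  have hcg : CodeFP TBE pcE (fun t => t.1.2.2.2) := (fst _ _).snd'.snd'.snd'
  have hS : CodeFP TBE matE (fun t => t.2.1.1) := (snd _ _).fst'.fst'
  have hU : CodeFP TBE matE (fun t => t.2.1.2) := (snd _ _).fst'.snd'
  have hxs : CodeFP TBE matE (fun t => t.2.2.1) := (snd _ _).snd'.fst'
  have hsel : CodeFP TBE bitsE (fun t => t.2.2.2) := (snd _ _).snd'.snd'
  have hv := candV_codeFP.comp (((hn.pair hcg).pair (hS.pair (hU.pair hxs))).pair hsel)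
  have hin := inSpan_codeFP.comp (hn.pair (hS.pair hv))
  have hB := basisOf_codeFP.comp (hn.pair ((rawAppend bitsE).comp (hS.pair ((rawSingleton bitsE).comp hv))))
  have hcl := closure_codeFP.comp ((hn.pair (hcf.pair hcg)).pair (hB.pair hU))
  have hok := okPair_codeFP.comp (hΓ.pair hcl)
  exact (hin.ite (const _ none) (hok.ite ((optSome prE).comp hcl) (const _ none))).congr fun _ => rfl

/-- **The `a`-side step on codes**: `(Γ, (p, (xs, sel))) ↦ tryA n m c_f c_g p xs sel`. [cite: AroraBarak2009, §1.3] -/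
theorem tryA_codeFP : CodeFP TBE (optE prE) (fun t => tryA t.1.1 t.1.2.1 t.1.2.2.1 t.1.2.2.2 t.2.1 t.2.2.1 t.2.2.2) := by
  have hn : CodeFP TBE unE (fun t => t.1.1) := (fst _ _).fst'
  have hm : CodeFP TBE unE (fun t => t.1.2.1) := (fst _ _).snd'.fst'
  have hcf : CodeFP TBE pcE (fun t => t.1.2.2.1) := (fst _ _).snd'.snd'.fst'
  have hcg : CodeFP TBE pcE (fun t => t.1.2.2.2) := (fst _ _).snd'.snd'.snd'
  have hS : CodeFP TBE matE (fun t => t.2.1.1) := (snd _ _).fst'.fst'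
  have hU : CodeFP TBE matE (fun t => t.2.1.2) := (snd _ _).fst'.snd'
  have hrest : CodeFP TBE (pairE matE bitsE) (fun t => t.2.2) := (snd _ _).snd'
  have hctx : CodeFP TBE TBE (fun t => ((t.1.1, (t.1.2.1, (t.1.2.2.2, t.1.2.2.1))), ((t.2.1.2, t.2.1.1), t.2.2))) :=
    (hn.pair (hm.pair (hcg.pair hcf))).pair ((hU.pair hS).pair hrest)
  have hB := tryB_codeFP.comp hctx
  have hswap : CodeFP (pairE TBE prE) prE (fun q => q.2.swap) := (snd TBE prE).snd'.pair (snd TBE prE).fst'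
  have hmap := optMap (σ := (ℕ × (ℕ × (PCirc × PCirc))) × ((Mat × Mat) × (Mat × Vec))) (eσ := TBE) (eα := prE) (eβ := prE)
    (g := fun q => q.2.swap) hswap
  exact (hmap.comp ((CodeFP.id _).pair hB)).congr fun _ => rfl

end Summit.QuantumAdvantage.QuantumAdvantage.Theorems.SignedExactCubicForrelationNotPrBPP.GrowMachine

end
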